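import Literature.Geometry.Lorentzian.WindowedCollarCurvatureTracking
import HarnessLib

/-!
# The Kretschmann scalar is `O(δ²)` at `C²`-`δ`-quiet points of a flat chart
(crux `LaminatedThreshold`, idea `horizon-shadowed-bag`, pieces (s3b)/(s3c))

The typed-GR engine of the CURVATURE WALL route to piece (s3c) `NoFlatChartInLateBag` and of
piece (s3b) ("`K < κ₀` on the flat late region for `τ₁` large") of the passed crux idea
`Cruxes/LaminatedThreshold/Ideas/horizon-shadowed-bag.md` (round 2; `TRIAGE-r2-1.md` (c):
"`ε`-flat chart points have Kretschmann `≤ Cε²`"; `TRIAGE-r2-2.md`): at a point of a chart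
modelled on the Minkowski background whose metric deviation `Ψ^* g − η` has `2`-jet of size
`≤ δ ≤ δ₁`, the Kretschmann scalar `|Rm|²` of the host spacetime is at most `A δ²`, with
constants `δ₁, A` depending on NOTHING (`exists_abs_kretschmannAt_le_of_jets`, pointwise;
`abs_kretschmannAt_le_of_deviationCk_le`, slab form in the vocabulary of
`FinalStateDecomposition`); consequently along ANY final-state decomposition of order `k ≥ 2`
the Kretschmann scalar of the host is eventually (in flat chart time) smaller than any `κ > 0`
on the flat chart's image of the late flat slabs (`eventually_abs_kretschmannAt_flatChart_lt`) —
so a connected late flat-chart image never meets a curvature curtain `{κ₀ ≤ |Rm|²}`.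

The proof is the flat specialisation of the curvature-tracking theorem
`KerrWindow.abs_kretschmannAt_sub_rmNormSqAt_le` (`WindowedCollarCurvatureTracking.lean`): read the
host through the parametrisation `Ψ ∘ (chartAt E4 x)⁻¹`, whose components `F` have `2`-jet
`δ`-close to the CONSTANT components `η` (`KerrWindow.jets_deviationExtend_general`); `F(x)` is
nondegenerate with `‖F(x)⁻¹‖ ≤ C` once `δ ≤ δ₁` (`KerrWindow.exists_uniform_inverse_bound` at the
singleton `{η}`); the flat comparison `MetricCoord.IsMetricOn.abs_rmNormSqAt_le_of_flat_close`
(`FlatQuietCollarExclusion.lean`, Kotschwar 2014 (8) with `R_η = 0`) gives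
`|Rm|²_F(x) ≤ 4⁵ N² (42 N⁵ δ)²`, and `|Rm|²_F(x)` IS the Kretschmann scalar of the host at `Ψ x`
(chart independence, `Spacetime.rmNormSqAt_metricInCoords_eq_kretschmannAt`). Everything PROVED;
no named fact enters.
-/

noncomputable section

-- instance search through nested operator types (as in `CoordCurvature`)
set_option maxSynthPendingDepth 3
set_option linter.dupNamespace false

open Set Function Filter ContinuousLinearMap Metric
open scoped Topology Manifold ContDiff ENNReal

namespace Summit.FinalStateConjecture.FinalStateConjecture.Theorems.LaminatedThreshold.HorizonShadowedBag

open Literature.Geometry.Lorentzian Literature.Geometry.Lorentzian.MetricCoord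
  Literature.Geometry.Lorentzian.KerrWindow

/-- **Pointwise flat curvature tracking.** There are absolute constants `δ₁ > 0`, `A ≥ 0` such that
for every spacetime `𝓢`, every chart `Ψ` modelled on the Minkowski background on an open `U ⊆ E4`,
smooth on an open set `L` of the domain, and every `x ∈ L` at which the extended deviation
`Ψ^* g − η` has `‖·‖, ‖D·‖, ‖D²·‖ ≤ δ ≤ δ₁`, the Kretschmann scalar of `𝓢` at `Ψ x` satisfies
`|kretschmannAt 𝓢 (Ψ x)| ≤ A δ²`. [cite: Kotschwar2014, §1.1 (8)] -/
theorem exists_abs_kretschmannAt_le_of_jets : ∃ δ₁ A : ℝ, 0 < δ₁ ∧ 0 ≤ A ∧ ∀ (𝓢 : Literature.Geometry.Lorentzian.Spacetime.{0} 4) (U : TopologicalSpace.Opens Literature.Geometry.Lorentzian.E4) (Ψ : (Literature.Geometry.Lorentzian.Minkowski.backgroundOn U).domain → 𝓢.carrier) (L : Set (Literature.Geometry.Lorentzian.Minkowski.backgroundOn U).domain) (δ : ℝ), IsOpen L → ContMDiffOn (modelWithCornersSelf ℝ Literature.Geometry.Lorentzian.E4) (modelWithCornersSelf ℝ Literature.Geometry.Lorentzian.E4)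 ((⊤ : ℕ∞) : WithTop ℕ∞) Ψ L → 0 ≤ δ → δ ≤ δ₁ → ∀ x ∈ L, ‖𝓢.deviationExtend (Literature.Geometry.Lorentzian.Minkowski.backgroundOn U) Ψ x‖ ≤ δ → ‖fderiv ℝ (𝓢.deviationExtend (Literature.Geometry.Lorentzian.Minkowski.backgroundOn U) Ψ) x‖ ≤ δ → ‖fderiv ℝ (fderiv ℝ (𝓢.deviationExtend (Literature.Geometry.Lorentzian.Minkowski.backgroundOn U) Ψ)) x‖ ≤ δ → |𝓢.kretschmannAt (Ψ x)| ≤ A * δ ^ 2 := by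
  classical
  set η : E4 →L[ℝ] E4 →L[ℝ] ℝ := Minkowski.bilin with hη
  have hηinv : η.IsInvertible := isInvertible_of_nondegenerate Minkowski.bilin_nondegenerate
  obtain ⟨δ₁, hδ₁, C, hC⟩ := exists_uniform_inverse_bound
    (K := ({η} : Set (E4 →L[ℝ] E4 →L[ℝ] ℝ))) isCompact_singleton
    (fun A hA ↦ by rw [mem_singleton_iff.1 hA]; exact hηinv)
  set N : ℝ := max C 1 with hN
  have hN1 : 1 ≤ N := le_max_right _ _
  have hCN : C ≤ N := le_max_left _ _
  have hN0 : 0 ≤ N := zero_le_one.trans hN1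
  set A : ℝ := (4 : ℝ) ^ 4 * N ^ 2 * (4 * (42 * N ^ 5) ^ 2) with hA
  have hA0 : 0 ≤ A := by positivity
  refine ⟨min δ₁ 1, A, lt_min hδ₁ one_pos, hA0,
    fun 𝓢 U Ψ L δ hL hΨ hδ0 hδle x hxL hd0 hd1 hd2 ↦ ?_⟩
  have hδ1 : δ ≤ 1 := hδle.trans (min_le_right _ _)
  have hδδ₁ : δ ≤ δ₁ := hδle.trans (min_le_left _ _)
  have hbil : (Minkowski.backgroundOn U).bilin = fun _ ↦ η := rfl
  set xe : E4 := (x : E4) with hxe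
  have hxeW₀ : xe ∈ (Subtype.val '' L : Set E4) := mem_image_of_mem Subtype.val hxL
  have hBsm : ∀ y ∈ (Subtype.val '' L : Set E4),
      ContDiffAt ℝ ∞ (Minkowski.backgroundOn U).bilin y := fun y _ ↦ by
    rw [hbil]; exact contDiffAt_const
  -- the chart components and the jets of the deviation as differences
  set F := 𝓢.metricInCoords (Ψ ∘ (chartAt E4 x).symm) with hFdef
  have hψsm : ContMDiffOn 𝓘(ℝ, E4) (𝓡 4) ∞ (Ψ ∘ (chartAt E4 x).symm) (Subtype.val '' L) :=
    contMDiffOn_comp_chartAt_symm_image hΨ x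
  have hO : IsOpen (Subtype.val '' L : Set E4) := isOpen_image_val hL
  have hFsmO : ContDiffOn ℝ ∞ F (Subtype.val '' L) := 𝓢.contDiffOn_metricInCoords hO hψsm
  obtain ⟨e0, e1, e2⟩ := jets_deviationExtend_general hΨ hL x hBsm hxeW₀
  have hD1 : fderiv ℝ (fun _ : E4 ↦ η) = fun _ ↦ 0 := by
    funext y; exact fderiv_const_apply η
  have hD1x : fderiv ℝ (fun _ : E4 ↦ η) xe = 0 := fderiv_const_apply η
  have hD2x : fderiv ℝ (fderiv ℝ (fun _ : E4 ↦ η)) xe = 0 := by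
    rw [hD1]; exact fderiv_const_apply (0 : E4 →L[ℝ] E4 →L[ℝ] E4 →L[ℝ] ℝ)
  have e0' : 𝓢.deviationExtend (Minkowski.backgroundOn U) Ψ xe = F xe - η := e0
  have e1' : fderiv ℝ (𝓢.deviationExtend (Minkowski.backgroundOn U) Ψ) xe =
      fderiv ℝ F xe - fderiv ℝ (fun _ : E4 ↦ η) xe := e1
  have e2' : fderiv ℝ (fderiv ℝ (𝓢.deviationExtend (Minkowski.backgroundOn U) Ψ)) xe =
      fderiv ℝ (fderiv ℝ F) xe - fderiv ℝ (fderiv ℝ (fun _ : E4 ↦ η)) xe := e2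
  have hc0 : ‖F xe - (fun _ : E4 ↦ η) xe‖ ≤ δ := by
    show ‖F xe - η‖ ≤ δ
    rw [← e0']; exact hd0
  have hc1 : ‖fderiv ℝ F xe - fderiv ℝ (fun _ : E4 ↦ η) xe‖ ≤ δ := by
    rw [← e1']; exact hd1
  have hc2 : ‖fderiv ℝ (fderiv ℝ F) xe - fderiv ℝ (fderiv ℝ (fun _ : E4 ↦ η)) xe‖ ≤ δ := by
    rw [← e2']; exact hd2
  -- the chart components are nondegenerate at `xe`, with inverse bounded by `C`; so is `η`
  have hG'inv : (F xe).IsInvertible ∧ ‖(F xe).inverse‖ ≤ C := by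
    refine hC η (mem_singleton η) (F xe) ?_
    have h : ‖F xe - η‖ ≤ δ := hc0
    exact h.trans hδδ₁
  have hηC : ‖η.inverse‖ ≤ C :=
    (hC η (mem_singleton η) η (by rw [sub_self, norm_zero]; exact hδ₁.le)).2
  -- `|Rm|²` of the chart components at `xe` is the Kretschmann scalar of `𝓢` at `Ψ x`
  have hKF : rmNormSqAt F xe = 𝓢.kretschmannAt (Ψ x) := by
    have h := 𝓢.rmNormSqAt_metricInCoords_eq_kretschmannAt hO hψsm hxeW₀ hG'inv.1
    have hxx : (Ψ ∘ (chartAt E4 x).symm) xe = Ψ x := comp_chartAt_symm_apply_coe x x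
    rw [hFdef, h, hxx]
  -- the open set of smooth nondegenerate chart points around `xe`
  set W : Set E4 := (Subtype.val '' L : Set E4) ∩ F ⁻¹' {T | T.IsInvertible} with hWdef
  have hW : IsOpen W :=
    hFsmO.continuousOn.isOpen_inter_preimage hO isOpen_setOf_isInvertible
  have hxeW : xe ∈ W := ⟨hxeW₀, hG'inv.1⟩
  have hWL : W ⊆ (Subtype.val '' L : Set E4) := inter_subset_left
  have hG'm : IsMetricOn F W :=
    { isOpen := hW
      contDiffOn := hFsmO.mono hWL
      symm := fun y _ v w ↦ 𝓢.metricInCoords_symm _ y v w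
      isInvertible := fun y hy ↦ hy.2 }
  have hηm : IsMetricOn (fun _ : E4 ↦ η) W :=
    KerrSchildChart.isMetricOn_mono isMetricOn_minkowski_const hW (subset_univ _)
  -- the bounds fed to the flat comparison
  have hs : ‖sharpAt F xe‖ ≤ N := by
    show ‖(F xe).inverse‖ ≤ N; exact hG'inv.2.trans hCN
  have hs' : ‖sharpAt (fun _ : E4 ↦ η) xe‖ ≤ N := by
    show ‖η.inverse‖ ≤ N; exact hηC.trans hCN
  have hn1 : ‖fderiv ℝ (fun _ : E4 ↦ η) xe‖ = 0 := by
    rw [hD1x]; exact norm_zero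
  have hn2 : ‖fderiv ℝ (fderiv ℝ (fun _ : E4 ↦ η)) xe‖ = 0 := by
    rw [hD2x]; exact ContinuousLinearMap.opNorm_zero
  have h1 : ‖fderiv ℝ F xe‖ ≤ N := by
    have h : ‖fderiv ℝ F xe‖ ≤ δ := by
      linarith [norm_sub_norm_le (fderiv ℝ F xe) (fderiv ℝ (fun _ : E4 ↦ η) xe)]
    exact h.trans (hδ1.trans hN1)
  have h1' : ‖fderiv ℝ (fun _ : E4 ↦ η) xe‖ ≤ N := by
    rw [hn1]; exact hN0
  have h2 : ‖fderiv ℝ (fderiv ℝ F) xe‖ ≤ N := by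
    have h : ‖fderiv ℝ (fderiv ℝ F) xe‖ ≤ δ := by
      linarith [norm_sub_norm_le (fderiv ℝ (fderiv ℝ F) xe)
        (fderiv ℝ (fderiv ℝ (fun _ : E4 ↦ η)) xe)]
    exact h.trans (hδ1.trans hN1)
  have hflat : ∀ X Y Z : E4, riemAt (fun _ : E4 ↦ η) xe X Y Z = 0 := fun X Y Z ↦
    riemAt_const η xe X Y Z
  have key := hG'm.abs_rmNormSqAt_le_of_flat_close (EuclideanSpace.basisFun (Fin 4) ℝ) hηm hxeW
    hN1 hδ0 hs hs' h1 h1' h2 hflat hc0 hc1 hc2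
  -- numerics
  have hcard : (Fintype.card (Fin 4) : ℝ) = 4 := by norm_num
  have hrank : (Module.finrank ℝ E4 : ℝ) = 4 := by
    rw [finrank_euclideanSpace_fin]; norm_num
  have hup : (4 : ℝ) ^ 4 * N ^ 2 * (4 * (42 * N ^ 5 * δ) ^ 2) = A * δ ^ 2 := by rw [hA]; ring
  rw [hcard, hrank, hKF, hup] at key
  exact key

/-- **Flat curvature tracking on a quiet slab.** With the constants `δ₁, A` of
`exists_abs_kretschmannAt_le_of_jets`: for a chart `Ψ` modelled on the Minkowski background on
`U`, smooth on its whole domain, whose `C²` deviation from `η` on the flat slab `{x⁰ = τ} ∩ U`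
(`Spacetime.deviationCk … 2 τ`, DHRT arXiv:2104.08222 §1) is `≤ δ ≤ δ₁`, the Kretschmann scalar of
the host is `≤ A δ²` in absolute value at the image of every slab point.
[cite: arXiv210408222, §1] [cite: Kotschwar2014, §1.1 (8)] -/
theorem abs_kretschmannAt_le_of_deviationCk_le : ∃ δ₁ A : ℝ, 0 < δ₁ ∧ 0 ≤ A ∧ ∀ (𝓢 : Literature.Geometry.Lorentzian.Spacetime.{0} 4) (U : TopologicalSpace.Opens Literature.Geometry.Lorentzian.E4) (Ψ : (Literature.Geometry.Lorentzian.Minkowski.backgroundOn U).domain → 𝓢.carrier) (τ δ : ℝ), ContMDiff (modelWithCornersSelf ℝ Literature.Geometry.Lorentzian.E4) (modelWithCornersSelf ℝ Literature.Geometry.Lorentzian.E4) ((⊤ : ℕ∞) : WithTop ℕ∞) Ψ → 0 ≤ δ → δ ≤ δ₁ → 𝓢.deviationCk (Literature.Geometry.Lorentzian.Minkowski.backgroundOn U) Ψ 2 τ ≤ ENNReal.ofReal δ → ∀ x : (Literature.Geometry.Lorentzian.Minkowski.backgroundOn U).domain, (x : Literature.Geometry.Lorentzian.E4) 0 = τ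 → |𝓢.kretschmannAt (Ψ x)| ≤ A * δ ^ 2 := by
  obtain ⟨δ₁, A, hδ₁, hA, h⟩ := exists_abs_kretschmannAt_le_of_jets
  refine ⟨δ₁, A, hδ₁, hA, fun 𝓢 U Ψ τ δ hΨ hδ0 hδle hle x hx ↦ ?_⟩
  have hslab : x ∈ (Minkowski.backgroundOn U).timeSlab τ := hx
  -- the jets of the deviation at `x` are `≤ δ`
  have hjet : ∀ m ≤ 2,
      ‖iteratedFDeriv ℝ m (𝓢.deviationExtend (Minkowski.backgroundOn U) Ψ) x‖ ≤ δ := by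
    intro m hm
    have h1 := enorm_iteratedFDeriv_le_supCkENorm hm (mem_image_of_mem Subtype.val hslab)
      (𝓢.deviationExtend (Minkowski.backgroundOn U) Ψ)
    have h2 : ‖iteratedFDeriv ℝ m (𝓢.deviationExtend (Minkowski.backgroundOn U) Ψ) x‖ₑ ≤
        ENNReal.ofReal δ := h1.trans hle
    rwa [← ofReal_norm, ENNReal.ofReal_le_ofReal_iff hδ0] at h2
  have hd0 : ‖𝓢.deviationExtend (Minkowski.backgroundOn U) Ψ x‖ ≤ δ := by
    have h := hjet 0 (by norm_num); rwa [norm_iteratedFDeriv_zero] at h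
  have hd1 : ‖fderiv ℝ (𝓢.deviationExtend (Minkowski.backgroundOn U) Ψ) x‖ ≤ δ := by
    have h := hjet 1 (by norm_num)
    rwa [← norm_iteratedFDeriv_fderiv (n := 0), norm_iteratedFDeriv_zero] at h
  have hd2 : ‖fderiv ℝ (fderiv ℝ (𝓢.deviationExtend (Minkowski.backgroundOn U) Ψ)) x‖ ≤ δ := by
    have h := hjet 2 le_rfl
    rwa [← norm_iteratedFDeriv_fderiv (n := 1), ← norm_iteratedFDeriv_fderiv (n := 0),
      norm_iteratedFDeriv_zero] at h
  exact h 𝓢 U Ψ univ δ isOpen_univ hΨ.contMDiffOn hδ0 hδle x (mem_univ x) hd0 hd1 hd2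

/-- **Along a final-state decomposition the flat chart's late slabs are eventually curvature-free to
any tolerance.** For `d : FinalStateDecomposition 𝓢 O k` with `k ≥ 2` and every `κ > 0` there is a
flat chart time `τ₁` after which `|kretschmannAt 𝓢 (d.flatChart x)| < κ` at every point `x` of the
flat domain with `x⁰ ≥ τ₁` (radiation-zone clause `tendsto_deviationCk_flat` + flat curvature
tracking). This is the (s3b)/(s3c) wall engine of crux idea `horizon-shadowed-bag`: a late flat-chart
image never meets a curvature curtain `{κ ≤ |Rm|²}`. [cite: arXiv210408222, §1] -/
theorem eventually_abs_kretschmannAt_flatChart_lt : ∀ {𝓢 : Literature.Geometry.Lorentzian.Spacetime.{0} 4} {O : Set 𝓢.carrier} {k : ℕ} (d : Literature.Geometry.Lorentzian.FinalStateDecomposition 𝓢 O k), 2 ≤ k → ∀ κ : ℝ, 0 < κ → ∃ τ₁ : ℝ, ∀ x : d.flatDomain, τ₁ ≤ (x : Literature.Geometry.Lorentzian.E4) 0 → |𝓢.kretschmannAt (d.flatChart x)| < κ := by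
  intro 𝓢 O k d hk κ hκ
  obtain ⟨δ₁, A, hδ₁, hA, h⟩ := abs_kretschmannAt_le_of_deviationCk_le
  -- a tolerance `δ` with `A δ² < κ`
  set δ : ℝ := min (min δ₁ 1) (κ / (2 * (A + 1))) with hδ
  have hA1 : 0 < A + 1 := by linarith
  have hδpos : 0 < δ := lt_min (lt_min hδ₁ one_pos) (by positivity)
  have hδδ₁ : δ ≤ δ₁ := (min_le_left _ _).trans (min_le_left _ _)
  have hδ1 : δ ≤ 1 := (min_le_left _ _).trans (min_le_right _ _)
  have hδκ : δ ≤ κ / (2 * (A + 1)) := min_le_right _ _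
  have hAδ : A * δ ^ 2 < κ := by
    have h1 : A * δ ^ 2 ≤ A * δ := by
      have : δ ^ 2 ≤ δ := by nlinarith
      exact mul_le_mul_of_nonneg_left this hA
    have h2 : A * δ ≤ (A + 1) * δ := by nlinarith
    have h3 : (A + 1) * δ ≤ (A + 1) * (κ / (2 * (A + 1))) := mul_le_mul_of_nonneg_left hδκ hA1.le
    have h4 : (A + 1) * (κ / (2 * (A + 1))) = κ / 2 := by field_simp
    linarith
  -- eventually the `Cᵏ` (hence `C²`) deviation on the flat slabs is `≤ δ`
  have hev : ∀ᶠ τ in atTop, 𝓢.deviationCk (Minkowski.backgroundOn d.flatDomain) d.flatChart k τ <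
      ENNReal.ofReal δ :=
    (tendsto_order.1 d.tendsto_deviationCk_flat).2 _ (ENNReal.ofReal_pos.2 hδpos)
  obtain ⟨τ₁, hτ₁⟩ := eventually_atTop.1 hev
  refine ⟨τ₁, fun x hx ↦ ?_⟩
  have hle : 𝓢.deviationCk (Minkowski.backgroundOn d.flatDomain) d.flatChart 2 ((x : E4) 0) ≤
      ENNReal.ofReal δ :=
    (𝓢.deviationCk_mono (Minkowski.backgroundOn d.flatDomain) d.flatChart hk _).trans (hτ₁ _ hx).le
  exact (h 𝓢 d.flatDomain d.flatChart ((x : E4) 0) δ d.isLateChart_flat.contMDiff hδpos.le hδδ₁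
    hle x rfl).trans_lt hAδ

end Summit.FinalStateConjecture.FinalStateConjecture.Theorems.LaminatedThreshold.HorizonShadowedBag

end
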